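import Mathlib
import Literature.Probability.LatticeModels.ThermodynamicLimit
import Literature.Probability.LatticeModels.SharpnessProofs
import Summits.CriticalPhenomena.Ising3DConformalLimit.Theorems.PrecisionLaplacianDirectCorrelationStableTailKernelScalingAux3
import HarnessLib

/-!
# Helpers (IV) for stub `stub_rieszGaussian` of line `diffusive-branch-is-nonsaturation`
(crux `PrecisionLaplacian.DirectCorrelationStableTail`, item stmt-CriticalPhenomena-4799)

**Real-variable bookkeeping** for the `ε`-management of `stub_rieszGaussian` (registered helper
sub-goal `stub_rieszGaussian_auxBookkeeping`): the window algebra `√(Σuᵢ²) ≤ t^{-1/4} ⟹ tρ ≤ √t,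
t|θ| ≤ √q √t` (`rieszG_window`), the choice of the small-`s` cut-off `σ` (`rieszG_choose_sigma`),
extraction of a threshold from the one-sided limit `∫ w_t → ∫ w_0` (`rieszG_eventually_close`),
and the two inequality chains (`rieszG_arith_a`, `rieszG_arith_b`) turning the core error bound of
file (III) into `≤ ε` on the window `|u|₂ ≤ t^{-1/4}` and `≤ ε|u|₂²` on `|u|₂ ≤ 1`.

Elementary (`import Mathlib` plus `kernSc_abs_one_sub_cos_le` of the landed `…KernelScalingAux3`);
all statements are folklore; no definitions are introduced.
-/

noncomputable section

namespace Summit.CriticalPhenomena.Ising3DConformalLimit.Cruxes.DirectCorrelationStableTail.DiffusiveBranchIsNonsaturation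

open MeasureTheory Filter Topology Set
open scoped BigOperators

/-! ### Real-variable bookkeeping for the window `|u|₂ ≤ t^{-1/4}` -/

/-- On the window `√ρ ≤ t^{-1/4}` with `0 < t ≤ 1`: `tρ ≤ √t`, and `t|θ| ≤ √q √t` whenever
`θ² ≤ qρ` (with `m = t^{-1/4} ≥ 1`: `t m⁴ = 1`, so `t m² = √t`). [folklore] -/
theorem rieszG_window {t ρ q θ : ℝ} (ht : 0 < t) (ht1 : t ≤ 1) (hρ : 0 ≤ ρ) (hq : 0 ≤ q)
    (hu : Real.sqrt ρ ≤ t ^ (-(1 / 4 : ℝ))) (hθ : θ ^ 2 ≤ q * ρ) :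
    t * ρ ≤ Real.sqrt t ∧ t * |θ| ≤ Real.sqrt q * Real.sqrt t := by
  set m : ℝ := t ^ (-(1 / 4 : ℝ)) with hm
  have hm1 : 1 ≤ m := Real.one_le_rpow_of_pos_of_le_one_of_nonpos ht ht1 (by norm_num)
  have hm0 : 0 ≤ m := zero_le_one.trans hm1
  have hm4 : t * m ^ 4 = 1 := by
    rw [hm, ← Real.rpow_natCast, ← Real.rpow_mul ht.le]
    norm_num
    rw [Real.rpow_neg_one, mul_inv_cancel₀ ht.ne']
  have hsqrt : Real.sqrt t = t * m ^ 2 := by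
    have h0 : 0 ≤ t * m ^ 2 := by positivity
    conv_lhs => rw [show t = (t * m ^ 2) ^ 2 by linear_combination (-t) * hm4]
    exact Real.sqrt_sq h0
  have hρm : ρ ≤ m ^ 2 := by
    have h := pow_le_pow_left₀ (Real.sqrt_nonneg ρ) hu 2
    rwa [Real.sq_sqrt hρ] at h
  have hθa : |θ| ≤ Real.sqrt q * Real.sqrt ρ := by
    rw [← Real.sqrt_sq_eq_abs, ← Real.sqrt_mul hq]
    exact Real.sqrt_le_sqrt hθ
  constructor
  · rw [hsqrt]
    exact mul_le_mul_of_nonneg_left hρm ht.le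
  · calc t * |θ| ≤ t * (Real.sqrt q * m) :=
          mul_le_mul_of_nonneg_left (hθa.trans (mul_le_mul_of_nonneg_left hu (Real.sqrt_nonneg q)))
            ht.le
      _ ≤ t * (Real.sqrt q * m) * m := le_mul_of_one_le_right (by positivity) hm1
      _ = Real.sqrt q * Real.sqrt t := by rw [hsqrt]; ring

/-- Choice of the cut-off `σ`: for `M > 0`, `ε > 0`, `1/2 ≤ β` there is `σ ∈ (0,1]` with
`M σ^β ≤ ε` (take `σ = min(1, (ε/M)²)` and use `σ^β ≤ σ^{1/2}` for `σ ≤ 1`). [folklore] -/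
theorem rieszG_choose_sigma {M ε β : ℝ} (hM : 0 < M) (hε : 0 < ε) (hβ : 1 / 2 ≤ β) :
    ∃ σ : ℝ, 0 < σ ∧ σ ≤ 1 ∧ M * σ ^ β ≤ ε := by
  refine ⟨min 1 ((ε / M) ^ 2), lt_min one_pos (by positivity), min_le_left _ _, ?_⟩
  set σ : ℝ := min 1 ((ε / M) ^ 2) with hσ
  have hσ0 : 0 < σ := lt_min one_pos (by positivity)
  have hσ1 : σ ≤ 1 := min_le_left _ _
  have h1 : σ ^ β ≤ σ ^ (1 / 2 : ℝ) := Real.rpow_le_rpow_of_exponent_ge hσ0 hσ1 hβ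
  have h2 : σ ^ (1 / 2 : ℝ) ≤ ε / M := by
    rw [← Real.sqrt_eq_rpow]
    calc Real.sqrt σ ≤ Real.sqrt ((ε / M) ^ 2) := Real.sqrt_le_sqrt (min_le_right _ _)
      _ = ε / M := Real.sqrt_sq (by positivity)
  calc M * σ ^ β ≤ M * (ε / M) := mul_le_mul_of_nonneg_left (h1.trans h2) hM.le
    _ = ε := by field_simp

/-- Extracting a threshold from a one-sided limit at `0⁺`: if `W t → W₀` as `t → 0⁺` then
`|W t − W₀| ≤ δ` for `0 < t < t₁`. [folklore] -/
theorem rieszG_eventually_close {W : ℝ → ℝ} {W₀ δ : ℝ}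
    (hT : Tendsto W (𝓝[>] 0) (𝓝 W₀)) (hδ : 0 < δ) :
    ∃ t₁ : ℝ, 0 < t₁ ∧ ∀ t : ℝ, 0 < t → t < t₁ → |W t - W₀| ≤ δ := by
  rcases Metric.tendsto_nhdsWithin_nhds.1 hT δ hδ with ⟨t₁, ht₁, h⟩
  refine ⟨t₁, ht₁, fun t ht htt => le_of_lt ?_⟩
  have := h (show t ∈ Ioi (0 : ℝ) from ht) (by rwa [dist_zero_right, Real.norm_of_nonneg ht.le])
  rwa [Real.dist_eq] at this

/-- `|1 − cos θ| ≤ 2`. [folklore] -/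
theorem rieszG_abs_one_sub_cos_le_two (θ : ℝ) : |1 - Real.cos θ| ≤ 2 := by
  have h1 := Real.cos_le_one θ
  have h2 := Real.neg_one_le_cos θ
  rw [abs_le]
  constructor <;> linarith

/-- **Bookkeeping for the uniform claim (a).**  With the cut-off `σ` chosen so that
`κ L β⁻¹ (2+q) σ^β ≤ ε/3`, the dominated-convergence threshold giving
`|∫w_t − W₀| ≤ ε/(3κ(2+q))`, and `√t ≤ εσ/(3κ(W̄+1)(√q+1)²)`, the core error bound with
`(c₁,c₂) = (2,|θ|)` is at most `ε/κ` on the window (`t|θ| ≤ √q√t`, `tρ ≤ √t`). [folklore] -/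
theorem rieszG_arith_a {κ L β σ q t ρ θ Wbar ε dW : ℝ} (hκ : 0 < κ) (hL : 0 ≤ L) (hβ : 0 < β)
    (hσ0 : 0 < σ) (hσ1 : σ ≤ 1) (hq : 0 < q) (hW : 0 ≤ Wbar) (hε : 0 < ε) (hdW0 : 0 ≤ dW)
    (hσβ : κ * L / β * (2 + q) * σ ^ β ≤ ε / 3)
    (hdW : dW ≤ ε / (3 * κ * (2 + q)))
    (hτ : Real.sqrt t ≤ ε * σ / (3 * κ * (Wbar + 1) * (Real.sqrt q + 1) ^ 2))
    (h1 : t * |θ| ≤ Real.sqrt q * Real.sqrt t) (h2 : t * ρ ≤ Real.sqrt t) :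
    κ * (2 * L * (σ ^ β / β) + (t / σ * |θ| + t * ρ) * Wbar + |1 - Real.cos θ| * dW) ≤ ε := by
  have hsq : 0 ≤ Real.sqrt q := Real.sqrt_nonneg q
  set S := Real.sqrt t with hS
  have hS0 : 0 ≤ S := Real.sqrt_nonneg t
  have hσβ0 : 0 ≤ σ ^ β := Real.rpow_nonneg hσ0.le _
  -- term 1
  have e1 : κ * (2 * L * (σ ^ β / β)) ≤ ε / 3 := by
    refine le_trans ?_ hσβ
    have : κ * L / β * (2 + q) * σ ^ β - κ * (2 * L * (σ ^ β / β)) =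
        κ * L / β * q * σ ^ β := by
      field_simp
      ring
    nlinarith [this, show 0 ≤ κ * L / β * q * σ ^ β by positivity]
  -- term 2
  have hR : 0 < 3 * κ * (Wbar + 1) * (Real.sqrt q + 1) ^ 2 := by positivity
  have hSR : S * (3 * κ * (Wbar + 1) * (Real.sqrt q + 1) ^ 2) ≤ ε * σ := (le_div_iff₀ hR).1 hτ
  have hA : t / σ * |θ| + t * ρ ≤ (Real.sqrt q + 1) * S / σ := by
    have i1 : t / σ * |θ| ≤ Real.sqrt q * S / σ := by
      rw [div_mul_eq_mul_div]
      exact div_le_div_of_nonneg_right h1 hσ0.le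
    have i2 : t * ρ ≤ S / σ := by
      refine h2.trans ?_
      rw [le_div_iff₀ hσ0]
      nlinarith
    calc t / σ * |θ| + t * ρ ≤ Real.sqrt q * S / σ + S / σ := add_le_add i1 i2
      _ = (Real.sqrt q + 1) * S / σ := by ring
  have e2 : κ * ((t / σ * |θ| + t * ρ) * Wbar) ≤ ε / 3 := by
    have i1 : κ * ((t / σ * |θ| + t * ρ) * Wbar) ≤ κ * ((Real.sqrt q + 1) * S / σ * Wbar) :=
      mul_le_mul_of_nonneg_left (mul_le_mul_of_nonneg_right hA hW) hκ.le
    refine i1.trans ?_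
    rw [show κ * ((Real.sqrt q + 1) * S / σ * Wbar) = κ * (Real.sqrt q + 1) * S * Wbar / σ by ring,
      div_le_iff₀ hσ0]
    -- `κ(√q+1) S W̄ ≤ S R / 3 ≤ ε σ / 3`
    have i2 : κ * (Real.sqrt q + 1) * S * Wbar ≤
        S * (3 * κ * (Wbar + 1) * (Real.sqrt q + 1) ^ 2) / 3 := by
      have : S * (3 * κ * (Wbar + 1) * (Real.sqrt q + 1) ^ 2) / 3 - κ * (Real.sqrt q + 1) * S * Wbar
          = κ * (Real.sqrt q + 1) * S * ((Real.sqrt q + 1) * (Wbar + 1) - Wbar) := by ring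
      have hx : 0 ≤ (Real.sqrt q + 1) * (Wbar + 1) - Wbar := by nlinarith
      nlinarith [mul_nonneg (mul_nonneg (mul_nonneg hκ.le
        (by positivity : 0 ≤ Real.sqrt q + 1)) hS0) hx]
    nlinarith
  -- term 3
  have e3 : κ * (|1 - Real.cos θ| * dW) ≤ ε / 3 := by
    have i1 : |1 - Real.cos θ| * dW ≤ 2 * (ε / (3 * κ * (2 + q))) :=
      mul_le_mul (rieszG_abs_one_sub_cos_le_two θ) hdW hdW0 zero_le_two
    have i2 : κ * (2 * (ε / (3 * κ * (2 + q)))) = ε / 3 * (2 / (2 + q)) := by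
      field_simp
    have i3 : 2 / (2 + q) ≤ 1 := (div_le_one (by positivity)).2 (by linarith)
    calc κ * (|1 - Real.cos θ| * dW) ≤ κ * (2 * (ε / (3 * κ * (2 + q)))) :=
          mul_le_mul_of_nonneg_left i1 hκ.le
      _ = ε / 3 * (2 / (2 + q)) := i2
      _ ≤ ε / 3 * 1 := mul_le_mul_of_nonneg_left i3 (by positivity)
      _ = ε / 3 := mul_one _
  have : κ * (2 * L * (σ ^ β / β) + (t / σ * |θ| + t * ρ) * Wbar + |1 - Real.cos θ| * dW) =
      κ * (2 * L * (σ ^ β / β)) + κ * ((t / σ * |θ| + t * ρ) * Wbar) +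
        κ * (|1 - Real.cos θ| * dW) := by ring
  rw [this]
  linarith

/-- **Bookkeeping for the second-order claim (b).**  Under the same choices and
`t ≤ εσ/(3κ(W̄+1)(√q+1)²)`, the core error bound with `(c₁,c₂) = (θ²,θ²)`, `θ² ≤ qρ`, is at most
`ερ/κ`. [folklore] -/
theorem rieszG_arith_b {κ L β σ q t ρ θ Wbar ε dW : ℝ} (hκ : 0 < κ) (hL : 0 ≤ L) (hβ : 0 < β)
    (hσ0 : 0 < σ) (hσ1 : σ ≤ 1) (hq : 0 < q) (hW : 0 ≤ Wbar) (hε : 0 < ε) (hdW0 : 0 ≤ dW)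
    (ht : 0 < t) (hρ : 0 ≤ ρ) (hθ : θ ^ 2 ≤ q * ρ)
    (hσβ : κ * L / β * (2 + q) * σ ^ β ≤ ε / 3)
    (hdW : dW ≤ ε / (3 * κ * (2 + q)))
    (hτ : t ≤ ε * σ / (3 * κ * (Wbar + 1) * (Real.sqrt q + 1) ^ 2)) :
    κ * (θ ^ 2 * L * (σ ^ β / β) + (t / σ * θ ^ 2 + t * ρ) * Wbar + |1 - Real.cos θ| * dW) ≤
      ε * ρ := by
  have hsq : 0 ≤ Real.sqrt q := Real.sqrt_nonneg q
  have hsq2 : Real.sqrt q ^ 2 = q := Real.sq_sqrt hq.le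
  have hσβ0 : 0 ≤ σ ^ β := Real.rpow_nonneg hσ0.le _
  have hθ0 : 0 ≤ θ ^ 2 := sq_nonneg θ
  -- term 1
  have e1 : κ * (θ ^ 2 * L * (σ ^ β / β)) ≤ ε / 3 * ρ := by
    have i1 : κ * (θ ^ 2 * L * (σ ^ β / β)) ≤ κ * (q * ρ * L * (σ ^ β / β)) := by
      refine mul_le_mul_of_nonneg_left ?_ hκ.le
      have : 0 ≤ L * (σ ^ β / β) := by positivity
      nlinarith
    have i2 : κ * (q * ρ * L * (σ ^ β / β)) = ρ * (κ * L / β * q * σ ^ β) := by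
      field_simp
    have i3 : κ * L / β * q * σ ^ β ≤ κ * L / β * (2 + q) * σ ^ β := by
      have : 0 ≤ κ * L / β * σ ^ β := by positivity
      nlinarith
    rw [i2] at i1
    nlinarith [mul_le_mul_of_nonneg_left (i3.trans hσβ) hρ]
  -- term 2
  have hR : 0 < 3 * κ * (Wbar + 1) * (Real.sqrt q + 1) ^ 2 := by positivity
  have htR : t * (3 * κ * (Wbar + 1) * (Real.sqrt q + 1) ^ 2) ≤ ε * σ := (le_div_iff₀ hR).1 hτ
  have e2 : κ * ((t / σ * θ ^ 2 + t * ρ) * Wbar) ≤ ε / 3 * ρ := by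
    have hA : t / σ * θ ^ 2 + t * ρ ≤ t * ρ * (q + 1) / σ := by
      have i1 : t / σ * θ ^ 2 ≤ t / σ * (q * ρ) := mul_le_mul_of_nonneg_left hθ (by positivity)
      have i2 : t * ρ ≤ t * ρ / σ := by
        rw [le_div_iff₀ hσ0]
        have : 0 ≤ t * ρ := by positivity
        nlinarith
      calc t / σ * θ ^ 2 + t * ρ ≤ t / σ * (q * ρ) + t * ρ / σ := add_le_add i1 i2
        _ = t * ρ * (q + 1) / σ := by ring
    have i1 : κ * ((t / σ * θ ^ 2 + t * ρ) * Wbar) ≤ κ * (t * ρ * (q + 1) / σ * Wbar) :=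
      mul_le_mul_of_nonneg_left (mul_le_mul_of_nonneg_right hA hW) hκ.le
    refine i1.trans ?_
    rw [show κ * (t * ρ * (q + 1) / σ * Wbar) = ρ * (κ * (q + 1) * Wbar * t) / σ by ring,
      div_le_iff₀ hσ0]
    -- `κ (q+1) W̄ t ≤ t R / 3 ≤ ε σ / 3`
    have i2 : κ * (q + 1) * Wbar * t ≤ t * (3 * κ * (Wbar + 1) * (Real.sqrt q + 1) ^ 2) / 3 := by
      have e : t * (3 * κ * (Wbar + 1) * (Real.sqrt q + 1) ^ 2) / 3 - κ * (q + 1) * Wbar * t =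
          κ * t * ((Real.sqrt q + 1) ^ 2 * (Wbar + 1) - (q + 1) * Wbar) := by ring
      have hx : 0 ≤ (Real.sqrt q + 1) ^ 2 * (Wbar + 1) - (q + 1) * Wbar := by
        have : q + 1 ≤ (Real.sqrt q + 1) ^ 2 := by nlinarith
        nlinarith
      nlinarith [mul_nonneg (mul_nonneg hκ.le ht.le) hx]
    have i3 : ρ * (κ * (q + 1) * Wbar * t) ≤ ρ * (ε * σ / 3) :=
      mul_le_mul_of_nonneg_left (i2.trans (by linarith [htR])) hρ
    exact i3.trans (le_of_eq (by ring))
  -- term 3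
  have e3 : κ * (|1 - Real.cos θ| * dW) ≤ ε / 3 * ρ := by
    have i1 : |1 - Real.cos θ| * dW ≤ (q * ρ / 2) * (ε / (3 * κ * (2 + q))) :=
      mul_le_mul ((kernSc_abs_one_sub_cos_le θ).trans (by linarith)) hdW hdW0 (by positivity)
    have i2 : κ * ((q * ρ / 2) * (ε / (3 * κ * (2 + q)))) = ε / 3 * ρ * (q / (2 * (2 + q))) := by
      field_simp
    have i3 : q / (2 * (2 + q)) ≤ 1 := (div_le_one (by positivity)).2 (by linarith)
    calc κ * (|1 - Real.cos θ| * dW) ≤ κ * ((q * ρ / 2) * (ε / (3 * κ * (2 + q)))) :=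
          mul_le_mul_of_nonneg_left i1 hκ.le
      _ = ε / 3 * ρ * (q / (2 * (2 + q))) := i2
      _ ≤ ε / 3 * ρ * 1 := mul_le_mul_of_nonneg_left i3 (by positivity)
      _ = ε / 3 * ρ := mul_one _
  have : κ * (θ ^ 2 * L * (σ ^ β / β) + (t / σ * θ ^ 2 + t * ρ) * Wbar + |1 - Real.cos θ| * dW) =
      κ * (θ ^ 2 * L * (σ ^ β / β)) + κ * ((t / σ * θ ^ 2 + t * ρ) * Wbar) +
        κ * (|1 - Real.cos θ| * dW) := by ring
  rw [this]
  linarith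

/-- **Registered helper sub-goal `stub_rieszGaussian_auxBookkeeping`** of stub `stub_rieszGaussian`
(line `diffusive-branch-is-nonsaturation`, crux stmt-CriticalPhenomena-4799): the two inequality
chains `rieszG_arith_a` / `rieszG_arith_b` closing claims (a) and (b). [folklore] -/
theorem stub_rieszGaussian_auxBookkeeping :
    ∀ (κ L β σ q t ρ θ Wbar ε dW : ℝ), 0 < κ → 0 ≤ L → 0 < β → 0 < σ → σ ≤ 1 → 0 < q →
      0 ≤ Wbar → 0 < ε → 0 ≤ dW →
      κ * L / β * (2 + q) * σ ^ β ≤ ε / 3 → dW ≤ ε / (3 * κ * (2 + q)) →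
      (Real.sqrt t ≤ ε * σ / (3 * κ * (Wbar + 1) * (Real.sqrt q + 1) ^ 2) →
        t * |θ| ≤ Real.sqrt q * Real.sqrt t → t * ρ ≤ Real.sqrt t →
        κ * (2 * L * (σ ^ β / β) + (t / σ * |θ| + t * ρ) * Wbar + |1 - Real.cos θ| * dW) ≤ ε) ∧
      (0 < t → 0 ≤ ρ → θ ^ 2 ≤ q * ρ →
        t ≤ ε * σ / (3 * κ * (Wbar + 1) * (Real.sqrt q + 1) ^ 2) →
        κ * (θ ^ 2 * L * (σ ^ β / β) + (t / σ * θ ^ 2 + t * ρ) * Wbar + |1 - Real.cos θ| * dW) ≤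
          ε * ρ) :=
  fun _κ _L _β _σ _q _t _ρ _θ _Wbar _ε _dW hκ hL hβ hσ0 hσ1 hq hW hε hdW0 hσβ hdW =>
    ⟨fun hτ h1 h2 => rieszG_arith_a hκ hL hβ hσ0 hσ1 hq hW hε hdW0 hσβ hdW hτ h1 h2,
      fun ht hρ hθ hτ => rieszG_arith_b hκ hL hβ hσ0 hσ1 hq hW hε hdW0 ht hρ hθ hσβ hdW hτ⟩

end Summit.CriticalPhenomena.Ising3DConformalLimit.Cruxes.DirectCorrelationStableTail.DiffusiveBranchIsNonsaturation

end
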